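import Mathlib
import Summits.Ventures.HodgeRepro.Tier4.Line1.RTFSetting
import Summits.Ventures.HodgeRepro.Tier4.Line1.MaximalFamily
import Summits.Ventures.HodgeRepro.Tier4.Line1.HeckeFiniteness
import Summits.Ventures.HodgeRepro.Tier4.Line1.HeckeIsolation
import Summits.Ventures.HodgeRepro.Tier4.Line1.JacobsonBlock
import Summits.Ventures.HodgeRepro.Tier4.Line1.HeckeRankOneOfBlock

/-!
# Tier4/Line1/HeckeIsolationHecke — (S3a) with the isolating pair IN THE HECKE ALGEBRA, and the dictionary clause (S3b)
reduced to Hecke-algebra pairs (module 3b of the self-pointed cut S13690 / S13715 / S13738)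

Blind re-derivation cell `pub-hodge-repro`, Tier 4 (README §9–§10), seat t4-L1-p5 (prover, LINE L1, gen 3).  Target tree
path `lean/Summits/Ventures/HodgeRepro/Tier4/Line1/HeckeIsolationHecke.lean`.  Imports this seat's `HeckeIsolation`
(p683711) and `HeckeRankOneOfBlock` (p684520: `HeckeBlock`, `blockAdmissible`, `pairing`, `target`,
`eq_zero_of_mem_block_of_not_idx`), t4-L1-p1 g3's `JacobsonBlock` (p684029), `HeckeFiniteness`, `MaximalFamily`.

WHAT THIS IS.  `HeckeRankOneOfBlock.heckeRankOne` exhibits the rank-one realiser as the test function `tst r` of some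
Hecke element `r ∈ H` but forgets `r` inside the existential of `HeckeRankOne`.  Here `r` is kept:
* `exists_hecke_rankOne`: for admissible `v, w` there is `r ∈ H` with `R(tst r) = 0` on every other constituent and
  `R(tst r) = ⟪·, v⟫ w` on `τ m` (the proof of `heckeRankOne`, with `r` retained);
* `exists_isolatedAt_hecke` ((S3a) in the Hecke algebra): for admissible `w, w'` carrying the two toric periods, the
  pair `(cj (tst r), refl (tst r'))` isolates `τ m`;
* `RealisedHecke` ((S3b) for Hecke-algebra pairs, DISPLAYED — weaker than `HeckeIsolation.Realised`): an isolating
  pair of Hecke elements is the test pair of some Hecke choice of translates;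
* `isolationRealised_of_heckeBlock`: (S3″) `IsolationRealised` from one displayed `HeckeBlock` per constituent (same
  Hecke algebra `H`, same `tst`), the admissible-density clauses on the blocks, and `RealisedHecke`.
Nothing of (C1), (C2), the block data, the idempotent identities, the density clauses or the dictionary is proved:
they are fields / hypotheses, displayed by name.  Nothing here says anything about the status of the Hodge conjecture
for CM abelian varieties, which is NOT proved (HC_CM is NOT proved by anyone in this repository).
-/

set_option autoImplicit false

noncomputable section

namespace Summit.Ventures.HodgeRepro.Tier4.Line1

namespace RTF.Setting.HeckeBlock

variable {G : Type} [Group G] [TopologicalSpace G] [IsTopologicalGroup G] [MeasurableSpace G] [BorelSpace G]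
  {S : Setting G} {τ : ℕ → Set (G → ℂ)} {m : ℕ} {H : Type} [Ring H] [Algebra ℂ H] {ι : Type} [Fintype ι]
  [DecidableEq ι] {Vb : Submodule ℂ (G → ℂ)} [FiniteDimensional ℂ Vb] [Module H Vb] [IsScalarTower ℂ H Vb]
  (D : HeckeBlock S τ m H ι Vb)

omit [IsTopologicalGroup G] in
/-- **the rank-one Hecke element, retained**: for admissible `v, w` there is `r ∈ H` whose test function `tst r` kills
every other constituent and acts on `τ m` as `⟪·, v⟫ w` (the content of `heckeRankOne` with the Hecke element kept). -/
theorem exists_hecke_rankOne [Countable S.Gk] [MeasurableMul G] {φ : ℕ → G → ℂ} {n : ℕ → ℕ}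
    (hB : S.IsAdaptedONB τ φ n) {v w : G → ℂ} (hv : v ∈ blockAdmissible τ m Vb) (hw : w ∈ blockAdmissible τ m Vb) :
    ∃ r : H, (∀ m', m' ≠ m → ∀ ψ ∈ τ m', S.R (D.tst r) ψ = fun _ => 0) ∧
      (∀ ψ ∈ τ m, S.R (D.tst r) ψ = fun x => S.inner ψ v * w x) := by
  classical
  haveI := D.simple
  have hvc : Continuous v := (hB.inv m).cont v hv.2
  let T : ∀ i, Module.End ℂ (D.W i) := fun i => (D.pairing hB.inv hvc i).smulRight (D.target hw i)
  obtain ⟨r, hr⟩ := JacobsonBlock.blockAlgebra_realises D.W D.π D.hπmem D.hπsum D.hπid D.hπzero D.hnon T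
  refine ⟨r, ?_, ?_⟩
  · intro m' hm' ψ hψ
    obtain ⟨heV, heτ⟩ := D.he_mem m' ψ hψ
    rw [D.he_R]
    by_cases hidx : ∃ i, D.idx i = m'
    · obtain ⟨i, hi⟩ := hidx
      have hi₀ : i ≠ D.i₀ := by
        intro h
        apply hm'
        rw [← hi, h, D.hi₀]
      have hmem : (⟨D.e ψ, heV⟩ : Vb) ∈ D.W i := by
        rw [D.hW, hi]
        exact heτ
      have h1 := hr i _ hmem
      have h2 : (T i ⟨⟨D.e ψ, heV⟩, hmem⟩ : Vb) = 0 := by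
        simp only [T, LinearMap.smulRight_apply, D.target_ne hw hi₀, smul_zero, Submodule.coe_zero]
      rw [h2] at h1
      have h3 := D.hact r ⟨D.e ψ, heV⟩
      rw [h1] at h3
      funext x
      have := congrFun h3 x
      simpa using this.symm
    · have hidx' : ∀ i, D.idx i ≠ m' := fun i h => hidx ⟨i, h⟩
      have h0 : D.e ψ = 0 := D.eq_zero_of_mem_block_of_not_idx hB hidx' heV heτ
      rw [h0, S.R_zero]
      rfl
  · intro ψ hψ
    obtain ⟨heV, heτ⟩ := D.he_mem m ψ hψ
    rw [D.he_R]
    have hmem : (⟨D.e ψ, heV⟩ : Vb) ∈ D.W D.i₀ := by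
      rw [D.hW, D.hi₀]
      exact heτ
    have h1 := hr D.i₀ _ hmem
    have h2 : (T D.i₀ ⟨⟨D.e ψ, heV⟩, hmem⟩ : Vb) = S.inner (D.e ψ) v • (⟨w, hw.1⟩ : Vb) := by
      simp only [T, LinearMap.smulRight_apply]
      rw [Submodule.coe_smul_of_tower]
      have ht : (D.target hw D.i₀ : Vb) = ⟨w, hw.1⟩ := by
        simp only [target, dif_pos]
      rw [ht]
      rfl
    rw [h2] at h1
    have h3 := D.hact r ⟨D.e ψ, heV⟩
    rw [h1] at h3
    have h4 : S.inner (D.e ψ) v = S.inner ψ v := by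
      rw [D.he_adj, D.he_id v hv.1]
    funext x
    have := congrFun h3 x
    simp only [Submodule.coe_smul, Pi.smul_apply, smul_eq_mul] at this
    rw [← this, h4]

omit [IsTopologicalGroup G] in
/-- **(S3a) with the isolating pair IN THE HECKE ALGEBRA**: for admissible `w, w'` carrying the two toric periods, the
pair `(cj (tst r), refl (tst r'))` isolates `τ m`, where `tst r = ⟪·, w⟫ w` and `tst r' = ⟪·, w⟫ w'` on `τ m`
(the other blocks vanish termwise; the `m`-block is `ℓ'(w') · conj ℓ(w) · ⟪w, w⟫ ≠ 0`). -/
theorem exists_isolatedAt_hecke [Countable S.Gk] [MeasurableMul G] {χ : S.T → ℂ} {χ' : S.T' → ℂ}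
    {φ : ℕ → G → ℂ} {n : ℕ → ℕ} (hB : S.IsAdaptedONB τ φ n)
    (hT : ∃ w ∈ blockAdmissible τ m Vb, S.periodT χ (fun t => w t) ≠ 0)
    (hT' : ∃ w' ∈ blockAdmissible τ m Vb, S.periodT' χ' (fun t' => w' t') ≠ 0) :
    ∃ r r' : H, IsolatedAt S χ χ' φ n (cj (D.tst r)) (refl (D.tst r')) m := by
  obtain ⟨w, hwV, hw⟩ := hT
  obtain ⟨w', hw'V, hw'⟩ := hT'
  obtain ⟨r, hrkill, hrm⟩ := D.exists_hecke_rankOne hB hwV hwV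
  obtain ⟨r', _, hr'm⟩ := D.exists_hecke_rankOne hB hwV hw'V
  refine ⟨r, r', ?_, ?_⟩
  · intro m' hm'
    apply S.specBlock_eq_zero_of_R_eq_zero χ χ' φ n (cj (D.tst r)) (refl (D.tst r')) hB
    intro ψ hψ
    rw [cj_cj]
    exact hrkill m' hm' ψ hψ
  · have hwm : w ∈ τ m := hwV.2
    have hblock := S.specBlock_eq_of_rankOne χ χ' φ n (cj (D.tst r)) (refl (D.tst r')) hB hwm hwm
      (fun ψ hψ => by rw [cj_cj]; exact hrm ψ hψ) (fun ψ hψ => by rw [refl_refl]; exact hr'm ψ hψ)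
    rw [hblock]
    have hw0 : w ≠ 0 := by
      intro h0
      apply hw
      rw [h0]
      exact S.periodT_zero
    have hww : S.inner w w ≠ 0 :=
      S.inner_self_ne_zero_of_invariant ((hB.inv m).cont w hwm) ((hB.inv m).inv w hwm) hw0
    exact mul_ne_zero (mul_ne_zero hw' (by simpa using hw)) hww

end RTF.Setting.HeckeBlock

section InterfaceHecke

open NumberField Common PeriodCloser MeasureTheory

variable {Form : Type} [AddCommGroup Form] [Module ℂ Form] {A : FormAlgebra Form} {W : Witness A}
  {G : Type} [Group G] [TopologicalSpace G] [IsTopologicalGroup G] [MeasurableSpace G] [BorelSpace G]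
  (S : RTF.Setting G) (χ : S.T → ℂ) (χ' : S.T' → ℂ) (τ : ℕ → Set (G → ℂ)) (Lift : ℕ → Prop)
  (φ : ℕ → G → ℂ) (n : ℕ → ℕ) (tf : W.Translates → (G → ℂ) × (G → ℂ)) (H : Type) (tst : H → (G → ℂ))

/-- **(S3b) for Hecke-algebra pairs, DISPLAYED** (weaker than `Realised`): a pair of Hecke elements
`(cj (tst r), refl (tst r'))` isolating `τ m` is the test pair of some Hecke choice of translates.  A HYPOTHESIS
wherever it is used; proved nowhere (the dictionary, DATA). -/
def RealisedHecke : Prop :=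
  ∀ (m : ℕ) (r r' : H), S.IsolatedAt χ χ' φ n (RTF.cj (tst r)) (RTF.refl (tst r')) m →
    ∃ γ' : W.Translates, S.IsolatedAt χ χ' φ n (tf γ').1 (tf γ').2 m

omit [IsTopologicalGroup G] in
/-- **(S3″) from a family of displayed Hecke blocks**: `IsolationRealised` from one `HeckeBlock` per constituent (with
the SAME Hecke algebra `H` and test-function map `tst`), the admissible-density clauses on the blocks, and the
dictionary clause for Hecke-algebra pairs only.  The lift clause `Lift m` is not used. -/
theorem isolationRealised_of_heckeBlock [Countable S.Gk] [MeasurableMul G] [Ring H] [Algebra ℂ H]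
    (hB : S.IsAdaptedONB τ φ n) (ι : ℕ → Type) [∀ m, Fintype (ι m)] [∀ m, DecidableEq (ι m)]
    (Vb : ℕ → Submodule ℂ (G → ℂ)) [∀ m, FiniteDimensional ℂ (Vb m)] [∀ m, Module H (Vb m)]
    [∀ m, IsScalarTower ℂ H (Vb m)] (D : ∀ m, RTF.Setting.HeckeBlock S τ m H (ι m) (Vb m))
    (htst : ∀ m, (D m).tst = tst)
    (hPA : ∀ m, S.PeriodNonzeroT χ (τ m) →
      ∃ w ∈ RTF.Setting.blockAdmissible τ m (Vb m), S.periodT χ (fun t => w t) ≠ 0)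
    (hPA' : ∀ m, S.PeriodNonzeroT' χ' (τ m) →
      ∃ w' ∈ RTF.Setting.blockAdmissible τ m (Vb m), S.periodT' χ' (fun t' => w' t') ≠ 0)
    (hreal : RealisedHecke S χ χ' φ n tf H tst) : IsolationRealised S χ χ' τ Lift φ n tf := by
  intro m hT hT' _
  obtain ⟨r, r', hiso⟩ := (D m).exists_isolatedAt_hecke hB (hPA m hT) (hPA' m hT')
  rw [htst m] at hiso
  exact hreal m r r' hiso

end InterfaceHecke

end Summit.Ventures.HodgeRepro.Tier4.Line1

end
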